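import Summits.ResolutionOfSingularities.ResolutionOfSingularities.Theorems.FrobeniusLadderFInjectiveMacaulayficationS2ModificationAffine
import Mathlib.RingTheory.Localization.LocalizationLocalization
import Mathlib.RingTheory.Localization.Integral
import Mathlib.RingTheory.Localization.AtPrime.Basic
import Mathlib.RingTheory.KrullDimension.Basic
import Mathlib.RingTheory.IntegralClosure.IntegrallyClosed
import HarnessLib

/-!
# The affine S₂-modification algebra — file L3a: the local rings `A′_P` over `V(𝔟)` inside `K`;
# normality and Cohen–Macaulayness in dimension `≤ 1`
# (crux `FInjectiveMacaulayfication` stmt-ResolutionOfSingularities-15315, chain w45a, hole #3γ, FC′ rung r2 input S-S2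
# `FCForallExistsDimLe2.S2Modification`; res-L1-w45a-plan-1 R14.1 (5) «stub-3 := S2ModificationAffine L3»; construction =
# res-L1-w45a-stub-7's memo `D/res-D-pv-019/S2MOD-MEMO.md` §2 (b); seat res-L1-w45a-stub-3)

[OURS · L1 W4.5a] Support file (`--supports stmt-ResolutionOfSingularities-15315 --as helper`); NOT a statement of any manuscript;
no named fact; AI-written (AI review is weaker than expert review).

SETTING (file 1 `…S2ModificationAffine`): `A` a domain with fraction field `K`, `s` a finite set of non-zero elements,
`A′ = s2Mod A K s hs = Ā ∩ ⋂_{f ∈ s} A[1/f] ⊆ K`. For a prime `P` of `A′` this file realises the local ring `A′_P` as the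
subalgebra `locSub A K s hs P ⊆ K` (Mathlib's `Localization.subalgebra.ofField`; it IS a localisation of `A′` at `P`, so the
abstract `Localization.AtPrime A′ P` — the shape of a stalk of `Spec A′` — is ring-isomorphic to it), and proves, for `P ⊇ s`
(a point OVER `V(𝔟)`):

* `mem_locSub_iff'` — `x ∈ A′_P ↔ t·x ∈ A′` for some `t ∉ P`;
* `integralClosure_le_locSub` — **if `dim A′_P ≤ 1` then `Ā ⊆ A′_P`**: for `f ∈ s` the element `f ∈ P A′_P` is a non-zero
  element of the maximal ideal of a local domain of dimension `≤ 1`, so `A′_P[1/f] = K`; hence every `y ∈ Ā` is `ℓ / fⁿ` with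
  `ℓ ∈ A′_P`, i.e. `t·y ∈ A′[1/f] ⊆ A[1/f]` for some `t ∉ P`; and `t·y ∈ Ā` trivially (NO height bookkeeping and no hypothesis
  on `A` off `V(𝔟)` is needed);
* `isIntegrallyClosed_locSub` — hence **`A′_P` is integrally closed when `dim A′_P ≤ 1`** (an element of `K` integral over
  `A′_P` has a `P.primeCompl`-multiple integral over `A′`, hence over `A`, hence in `Ā ⊆ A′_P`);
* `cmClause_of_ringKrullDim_le_one` — a local domain of dimension `≤ 1` satisfies the crux's Cohen–Macaulay clause
  `NonFullLocusClosed.CMClause` (the only system of parameters is one non-zero element), and its instance `cmClause_locSub_of_le_one`.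

The dimension-2 Cohen–Macaulay clause (memo §2 (c), Krull's intersection theorem for `Ā_P` + equidimensionality of affine
domains) and the transport to `Localization.AtPrime A′ P` are file L3b `…S2ModificationAffineClauses`. [folklore; cite: EGAIV2, 5.10.16–17]
-/

-- single-problem summit: the doubled namespace component is forced
set_option linter.dupNamespace false

noncomputable section

namespace Summit.ResolutionOfSingularities.ResolutionOfSingularities.Theorems.FInjectiveMacaulayfication.S2ModificationAffineLocal

open Summit.ResolutionOfSingularities.ResolutionOfSingularities.Theorems.FInjectiveMacaulayfication
open S2ModificationAffine nonZeroDivisors IsLocalRing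

variable (A : Type) [CommRing A] [IsDomain A] (K : Type) [Field K] [Algebra A K] [IsFractionRing A K]
variable (s : Finset A) (hs : ∀ f ∈ s, f ≠ 0)

/-! ## §1 `A′_P` inside `K` -/

/-- **The local ring `A′_P` of the S₂-modification algebra at a prime `P`, realised inside `K`**: the localisation of the
domain `A′ = s2Mod A K s hs` at `P.primeCompl` as a subalgebra of the common fraction field `K`
(`Localization.subalgebra.ofField`). [folklore] -/
def locSub (P : Ideal (s2Mod A K s hs)) [P.IsPrime] : Subalgebra (s2Mod A K s hs) K :=
  Localization.subalgebra.ofField K P.primeCompl P.primeCompl_le_nonZeroDivisors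

/-- `A′_P ⊆ K` is a localisation of `A′` at `P`. [folklore] -/
instance isLocalization_locSub (P : Ideal (s2Mod A K s hs)) [P.IsPrime] :
    IsLocalization.AtPrime (locSub A K s hs P) P :=
  Localization.subalgebra.isLocalization_ofField K _ _

/-- Membership in `A′_P`: `x = b · t⁻¹` with `b ∈ A′`, `t ∈ A′ ∖ P`. [folklore] -/
theorem mem_locSub_iff (P : Ideal (s2Mod A K s hs)) [P.IsPrime] (x : K) :
    x ∈ locSub A K s hs P ↔ ∃ (b t : s2Mod A K s hs), t ∉ P ∧ x = (b : K) * ((t : K))⁻¹ := by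
  unfold locSub Localization.subalgebra.ofField
  rw [← SetLike.mem_coe, Subalgebra.coe_copy]
  simp only [Set.mem_setOf_eq, Ideal.mem_primeCompl_iff]
  constructor
  · rintro ⟨b, t, ht, rfl⟩
    exact ⟨b, t, ht, rfl⟩
  · rintro ⟨b, t, ht, rfl⟩
    exact ⟨b, t, ht, rfl⟩

/-- An element of `A′ ∖ P` is non-zero in `K`. [folklore] -/
theorem coe_ne_zero_of_not_mem (P : Ideal (s2Mod A K s hs)) [P.IsPrime] {t : s2Mod A K s hs} (ht : t ∉ P) :
    (t : K) ≠ 0 := by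
  intro h
  apply ht
  have : t = 0 := Subtype.ext h
  rw [this]
  exact P.zero_mem

/-- Membership in `A′_P`, multiplicative form: `x ∈ A′_P ↔ t · x ∈ A′` for some `t ∈ A′ ∖ P`. [folklore] -/
theorem mem_locSub_iff' (P : Ideal (s2Mod A K s hs)) [P.IsPrime] (x : K) :
    x ∈ locSub A K s hs P ↔ ∃ t : s2Mod A K s hs, t ∉ P ∧ (t : K) * x ∈ s2Mod A K s hs := by
  rw [mem_locSub_iff]
  constructor
  · rintro ⟨b, t, ht, rfl⟩
    refine ⟨t, ht, ?_⟩
    rw [mul_comm, mul_assoc, inv_mul_cancel₀ (coe_ne_zero_of_not_mem A K s hs P ht), mul_one]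
    exact b.2
  · rintro ⟨t, ht, hmem⟩
    refine ⟨⟨(t : K) * x, hmem⟩, t, ht, ?_⟩
    change x = (t : K) * x * ((t : K))⁻¹
    rw [mul_comm (t : K) x, mul_assoc, mul_inv_cancel₀ (coe_ne_zero_of_not_mem A K s hs P ht), mul_one]

/-- `A′ ⊆ A′_P` (the image of `A′` in `K` lies in `A′_P`). [folklore] -/
theorem coe_mem_locSub (P : Ideal (s2Mod A K s hs)) [P.IsPrime] (b : s2Mod A K s hs) :
    (b : K) ∈ locSub A K s hs P :=
  (mem_locSub_iff' A K s hs P _).mpr ⟨1, fun h => Ideal.IsPrime.ne_top' (P.eq_top_iff_one.mpr h), by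
    rw [OneMemClass.coe_one, one_mul]; exact b.2⟩

/-- The coercion `A′_P → K` of `algebraMap A′ A′_P b` is `b`. [folklore] -/
theorem coe_algebraMap (P : Ideal (s2Mod A K s hs)) [P.IsPrime] (b : s2Mod A K s hs) :
    ((algebraMap (s2Mod A K s hs) (locSub A K s hs P) b : locSub A K s hs P) : K) = (b : K) := rfl

/-- `A′` is integral over `A` (it lies in the integral closure). [folklore] -/
theorem isIntegral_s2Mod : Algebra.IsIntegral A (s2Mod A K s hs) :=
  ⟨fun b => (isIntegral_algHom_iff (s2Mod A K s hs).val Subtype.val_injective).mp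
    ((mem_s2Mod_iff A K s hs (b : K)).mp b.2).1⟩

/-! ## §2 Local domains of dimension `≤ 1` -/

/-- In a local domain of dimension `≤ 1`, a power of any element `f` of the maximal ideal is a multiple of any given
non-zero `ℓ` (the maximal ideal is the radical of every non-zero proper principal ideal). [folklore] -/
theorem exists_pow_eq_mul_of_krullDimLE_one (L : Type) [CommRing L] [IsDomain L] [IsLocalRing L] [Ring.KrullDimLE 1 L]
    {ℓ f : L} (hℓ : ℓ ≠ 0) (hf : f ∈ maximalIdeal L) : ∃ (n : ℕ) (m : L), f ^ n = ℓ * m := by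
  by_cases hu : IsUnit ℓ
  · obtain ⟨u, rfl⟩ := hu
    exact ⟨0, ↑u⁻¹, by rw [pow_zero, Units.mul_inv]⟩
  · have hrad : f ∈ (Ideal.span {ℓ}).radical := by
      rw [Ideal.radical_eq_sInf, Ideal.mem_sInf]
      rintro J ⟨hJ, hJp⟩
      haveI := hJp
      have hJne : J ≠ ⊥ := fun h => hℓ (by
        have := hJ (Ideal.mem_span_singleton_self ℓ)
        rwa [h, Ideal.mem_bot] at this)
      haveI : J.IsMaximal := Ideal.IsPrime.isMaximal_of_ne_bot hJp hJne
      rw [IsLocalRing.eq_maximalIdeal (inferInstance : J.IsMaximal)]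
      exact hf
    obtain ⟨n, hn⟩ := hrad
    obtain ⟨m, hm⟩ := Ideal.mem_span_singleton'.mp hn
    exact ⟨n, m, by rw [← hm, mul_comm]⟩

/-- **A local domain of dimension `≤ 1` satisfies the Cohen–Macaulay clause** (every system of parameters is weakly
regular): in dimension `0` there is nothing to check, in dimension `1` a system of parameters is one element `a` with
`√(a) = 𝔪 ≠ 0`, so `a ≠ 0` is a non-zero-divisor. [folklore] -/
theorem cmClause_of_ringKrullDim_le_one (L : Type) [CommRing L] [IsDomain L] [IsLocalRing L] (hd : ringKrullDim L ≤ 1) :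
    NonFullLocusClosed.CMClause L := by
  intro d hd' t ht
  match d with
  | 0 =>
    rw [List.ofFn_zero]
    exact RingTheory.Sequence.IsWeaklyRegular.nil L L
  | 1 =>
    rw [List.ofFn_succ, List.ofFn_zero]
    refine RingTheory.Sequence.IsWeaklyRegular.cons ?_ (RingTheory.Sequence.IsWeaklyRegular.nil L _)
    -- `t 0 ≠ 0`: otherwise `√(0) = 𝔪` forces `𝔪` nil, i.e. `L` a field of dimension `0 ≠ 1`
    have hmax : (Ideal.span (Set.range t)).radical = maximalIdeal L := IsLocalRing.eq_maximalIdeal ht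
    have ht0 : t 0 ≠ 0 := by
      intro h0
      have hrange : Set.range t = {0} := by
        ext x
        simp only [Set.mem_range, Set.mem_singleton_iff]
        constructor
        · rintro ⟨i, rfl⟩
          rw [Subsingleton.elim i 0, h0]
        · rintro rfl
          exact ⟨0, h0⟩
      rw [hrange] at hmax
      -- every element of `𝔪` is nilpotent, hence zero: `𝔪 = ⊥`, `L` is a field
      have hbot : maximalIdeal L = ⊥ := by
        refine le_bot_iff.mp fun x hx => ?_
        rw [← hmax] at hx
        obtain ⟨n, hn⟩ := hx
        rw [Ideal.span_singleton_eq_bot.mpr rfl, Ideal.mem_bot] at hn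
        exact Ideal.mem_bot.mpr (pow_eq_zero_iff'.mp hn).1
      have hF : IsField L := IsLocalRing.isField_iff_maximalIdeal_eq.mpr hbot
      have h0 : ringKrullDim L = 0 := by
        letI := hF.toField
        exact ringKrullDim_eq_zero_of_field L
      rw [h0] at hd'
      exact absurd hd' (by norm_num)
    exact (isLeftRegular_iff.mp (IsRegular.of_ne_zero' ht0).left)
  | d + 2 =>
    exfalso
    rw [hd'] at hd
    have : ((d + 2 : ℕ) : WithBot ℕ∞) ≤ (1 : ℕ) := hd
    have h' : d + 2 ≤ 1 := by exact_mod_cast this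
    omega

/-! ## §3 Over `V(𝔟)`, in dimension `≤ 1`: `Ā ⊆ A′_P`, and `A′_P` is integrally closed and Cohen–Macaulay -/

section OverV

variable (P : Ideal (s2Mod A K s hs)) [P.IsPrime]

/-- For `f ∈ s` with `f ∈ P`: the image of `f` in `A′_P` is a NON-ZERO element of the maximal ideal. [folklore] -/
theorem algebraMap_mem_maximalIdeal (f : A) (hf : f ∈ s) (hfP : algebraMap A (s2Mod A K s hs) f ∈ P) :
    haveI := IsLocalization.AtPrime.isLocalRing (locSub A K s hs P) P
    algebraMap (s2Mod A K s hs) (locSub A K s hs P) (algebraMap A (s2Mod A K s hs) f) ∈ maximalIdeal (locSub A K s hs P) ∧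
      algebraMap (s2Mod A K s hs) (locSub A K s hs P) (algebraMap A (s2Mod A K s hs) f) ≠ 0 := by
  haveI := IsLocalization.AtPrime.isLocalRing (locSub A K s hs P) P
  refine ⟨(IsLocalization.AtPrime.to_map_mem_maximal_iff (locSub A K s hs P) P _).mpr hfP, fun h => ?_⟩
  have h1 : ((algebraMap (s2Mod A K s hs) (locSub A K s hs P) (algebraMap A (s2Mod A K s hs) f) : locSub A K s hs P) : K)
      = algebraMap A K f := rfl
  rw [h] at h1
  exact hs f hf ((injective_iff_map_eq_zero (algebraMap A K)).mp (IsFractionRing.injective A K) f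
    (by rw [← h1]; rfl))

/-- **`Ā ⊆ A′_P` when `P ⊇ s` and `dim A′_P ≤ 1`.** For `f ∈ s`, `A′_P[1/f] = K` (a power of the non-zero element `f` of the
maximal ideal of the `≤ 1`-dimensional local domain `A′_P` is a multiple of any denominator), so `y ∈ Ā` is `ℓ / fⁿ` with
`ℓ ∈ A′_P`, i.e. `t · y ∈ A′[1/f] ⊆ A[1/f]` for some `t ∉ P`; multiplying the `t`'s over `f ∈ s` gives `t · y ∈ Ā ∩ ⋂ A[1/f] = A′`.
(Memo §2 (b): the stalk of the S₂-modification over a point of `F` of local dimension `1` is the stalk of the normalisation.)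
[folklore; cite: EGAIV2, 5.10.16–17] -/
theorem integralClosure_le_locSub (hP : ∀ (f : A), f ∈ s → algebraMap A (s2Mod A K s hs) f ∈ P)
    (hd : ringKrullDim (locSub A K s hs P) ≤ 1) (y : K) (hy : y ∈ integralClosure A K) :
    y ∈ locSub A K s hs P := by
  classical
  set L := locSub A K s hs P with hL
  haveI := IsLocalization.AtPrime.isLocalRing L P
  haveI : Ring.KrullDimLE 1 L := Ring.krullDimLE_iff.mpr hd
  -- per generator `f ∈ s`: some `t ∉ P` with `t · y ∈ A[1/f]`
  have key : ∀ f : s, ∃ t : s2Mod A K s hs, t ∉ P ∧ (t : K) * y ∈ awaySub A K f.1 (hs f.1 f.2) := by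
    rintro ⟨f, hf⟩
    obtain ⟨ℓ₁, ℓ₂, hℓ₂, hyq⟩ := IsFractionRing.div_surjective (A := L) y
    have hℓ₂0 : ℓ₂ ≠ 0 := nonZeroDivisors.ne_zero hℓ₂
    obtain ⟨hfm, hf0⟩ := algebraMap_mem_maximalIdeal A K s hs P f hf (hP f hf)
    set fL := algebraMap (s2Mod A K s hs) L (algebraMap A (s2Mod A K s hs) f) with hfL
    obtain ⟨n, m, hnm⟩ := exists_pow_eq_mul_of_krullDimLE_one L hℓ₂0 hfm
    -- `ℓ₁ · m ∈ A′_P`: write it as `b₀ / t`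
    obtain ⟨b₀, t, ht, heq⟩ := (mem_locSub_iff A K s hs P _).mp (ℓ₁ * m).2
    refine ⟨t, ht, ?_⟩
    have hfK : (algebraMap A K f) ≠ 0 :=
      fun h => hs f hf ((injective_iff_map_eq_zero (algebraMap A K)).mp (IsFractionRing.injective A K) f h)
    have htK : (t : K) ≠ 0 := coe_ne_zero_of_not_mem A K s hs P ht
    have hℓ₂K : ((ℓ₂ : L) : K) ≠ 0 := fun h => hℓ₂0 (Subtype.ext h)
    -- the identities in `K`
    have h1 : (algebraMap A K f) ^ n = ((ℓ₂ : L) : K) * ((m : L) : K) := by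
      have := congrArg (fun z : L => (z : K)) hnm
      simpa [hfL] using this
    have h2 : ((ℓ₁ : L) : K) * ((m : L) : K) * (t : K) = (b₀ : K) := by
      have : (((ℓ₁ * m : L)) : K) = (b₀ : K) * ((t : K))⁻¹ := heq
      rw [Subalgebra.coe_mul] at this
      rw [this, mul_assoc, inv_mul_cancel₀ htK, mul_one]
    have hy' : y = ((ℓ₁ : L) : K) / ((ℓ₂ : L) : K) := hyq.symm
    have h3 : (t : K) * y = (b₀ : K) * (algebraMap A K (f ^ n))⁻¹ := by
      rw [map_pow, hy', eq_mul_inv_iff_mul_eq₀ (pow_ne_zero n hfK), h1]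
      field_simp
      linear_combination h2
    rw [h3]
    exact Subalgebra.mul_mem _ (s2Mod_le_awaySub A K s hs f hf b₀.2)
      ((mem_awaySub_iff A K f (hs f hf) _).mpr ⟨1, n, by rw [map_one, one_mul]⟩)
  choose tf htfP htf using key
  -- the product of the `t_f`
  refine (mem_locSub_iff' A K s hs P y).mpr ⟨∏ f : s, tf f, ?_, ?_⟩
  · -- `∏ t_f ∉ P`
    have : (∏ f : s, tf f) ∈ P.primeCompl :=
      prod_mem (S := P.primeCompl) fun f _ => (Ideal.mem_primeCompl_iff.mpr (htfP f))
    exact Ideal.mem_primeCompl_iff.mp this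
  · rw [SubmonoidClass.coe_finsetProd]
    unfold s2Mod
    refine Algebra.mem_inf.mpr ⟨?_, Algebra.mem_iInf.mpr fun f => ?_⟩
    · -- `∈ Ā`: `t ∈ A′ ⊆ Ā`, `y ∈ Ā`
      refine Subalgebra.mul_mem _ (s2Mod_le_integralClosure A K s hs ?_) hy
      rw [← SubmonoidClass.coe_finsetProd]
      exact (∏ f : s, tf f).2
    · -- `∈ A[1/f]`: split off the factor `t_f`
      rw [← Finset.mul_prod_erase Finset.univ (fun g : s => ((tf g : s2Mod A K s hs) : K)) (Finset.mem_univ f),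
        mul_comm ((tf f : s2Mod A K s hs) : K), mul_assoc]
      refine Subalgebra.mul_mem _ ?_ (htf f)
      refine s2Mod_le_awaySub A K s hs f.1 f.2 ?_
      rw [← SubmonoidClass.coe_finsetProd]
      exact (∏ g ∈ Finset.univ.erase f, tf g).2


/-- **`A′_P` is integrally closed when `P ⊇ s` and `dim A′_P ≤ 1`**: an element of `K` integral over `A′_P` has a
`P.primeCompl`-multiple integral over `A′` (`IsIntegral.exists_multiple_integral_of_isLocalization`), hence over `A`
(`A′` is integral over `A`), i.e. in `Ā ⊆ A′_P`. (Memo §2 (b): over a point of `F` of local dimension `1` the stalks of the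
S₂-modification are localisations of the normalisation — DVRs or fields.) [folklore; cite: EGAIV2, 5.10.16–17] -/
theorem isIntegrallyClosed_locSub (hP : ∀ (f : A), f ∈ s → algebraMap A (s2Mod A K s hs) f ∈ P)
    (hd : ringKrullDim (locSub A K s hs P) ≤ 1) : IsIntegrallyClosed (locSub A K s hs P) := by
  haveI := isIntegral_s2Mod A K s hs
  -- instance-search guidance: `SMul A′ A′_P` through `Algebra`, not through `A′ ≤ K` acting on `A′_P`
  letI : SMul (s2Mod A K s hs) (locSub A K s hs P) := Algebra.toSMul
  haveI : IsScalarTower (s2Mod A K s hs) (locSub A K s hs P) K :=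
    IsScalarTower.subalgebra' (s2Mod A K s hs) K K (locSub A K s hs P)
  refine (isIntegrallyClosed_iff (R := locSub A K s hs P) K).mpr fun {x} hx => ?_
  obtain ⟨m, hm⟩ := hx.exists_multiple_integral_of_isLocalization (R := s2Mod A K s hs) (M := P.primeCompl)
  have hmA : IsIntegral A ((m : s2Mod A K s hs) • x) := isIntegral_trans (R := A) _ hm
  have hmem : (m : s2Mod A K s hs) • x ∈ locSub A K s hs P :=
    integralClosure_le_locSub A K s hs P hP hd _ ((mem_integralClosure_iff A K).mpr hmA)
  rw [Algebra.smul_def] at hmem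
  change ((m : s2Mod A K s hs) : K) * x ∈ locSub A K s hs P at hmem
  obtain ⟨t, ht, hmem'⟩ := (mem_locSub_iff' A K s hs P _).mp hmem
  have hx' : x ∈ locSub A K s hs P := by
    refine (mem_locSub_iff' A K s hs P x).mpr ⟨t * (m : s2Mod A K s hs), ?_, ?_⟩
    · exact Ideal.mem_primeCompl_iff.mp (P.primeCompl.mul_mem (Ideal.mem_primeCompl_iff.mpr ht) m.2)
    · rw [Subalgebra.coe_mul, mul_assoc]
      exact hmem'
  exact ⟨⟨x, hx'⟩, rfl⟩

/-- **The Cohen–Macaulay clause for `A′_P` when `dim A′_P ≤ 1`** (a local domain of dimension `≤ 1`). [folklore] -/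
theorem cmClause_locSub_of_le_one (hd : ringKrullDim (locSub A K s hs P) ≤ 1) :
    NonFullLocusClosed.CMClause (locSub A K s hs P) := by
  haveI := IsLocalization.AtPrime.isLocalRing (locSub A K s hs P) P
  exact cmClause_of_ringKrullDim_le_one (locSub A K s hs P) hd

end OverV

end Summit.ResolutionOfSingularities.ResolutionOfSingularities.Theorems.FInjectiveMacaulayfication.S2ModificationAffineLocal

end
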